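import Literature.NumberTheory.EllipticCurves.HeathBrown1994.CongruentTwoSelmerMonskyFamilies
import Mathlib.NumberTheory.LegendreSymbol.QuadraticReciprocity
import Mathlib.Analysis.SpecialFunctions.Pow.Real
import HarnessLib

set_option linter.dupNamespace false -- `Summit.BirchSwinnertonDyer.BirchSwinnertonDyer.Theorems.…` (summit = sub, D-0017)
set_option autoImplicit false

/-!
# Crux `HeegnerTwistCouplingInSupply` (stmt-BirchSwinnertonDyer-21381), card `class-number-switch-duke-bilinear` —
# the elementary step «shrinking-disc pin ⟹ a `(3,+)` prime below `p^{1−δ}`» (`DukeShrinkingDiscPin ⟹ ResiduePinA`), PROVED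

Route `BiquadraticEisensteinDescent` (cell `pub/bsd-wall`; width seat `bsd-wall-cm-bed-w4` g25; theorems only,
`--supports 21381`). Kernel form of the card's sentence (Case A of `class-number-switch-duke-bilinear`, ideation seat 2 g27,
desk sketch `g27/Sketch.lean`, `ResiduePinA` as an «elementary consequence of `DukeShrinkingDiscPin`»): «`T = a² + 2b² ≡ 3 (8)`
has a prime factor `ℓ ≡ 3 (8)`, and `ℓ ∣ x² − 2p` forces `(2p/ℓ) = 1`, i.e. `(ℓ/p) = +1`: a `(3,+)` prime below `p^{1−δ}`».

* §1 ★ `exists_prime_dvd_mod_eight_eq_three` — for odd `a, b` the integer `a² + 2b²` has a prime factor `ℓ ≡ 3 (mod 8)`: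
  divide by `gcd(a,b)²`; every prime factor of a PRIMITIVE `a′² + 2b′²` satisfies `(−2/ℓ) = 1`, i.e. `ℓ ≡ 1, 3 (mod 8)`
  (`ZMod.exists_sq_eq_neg_two_iff`), and `a′² + 2b′² ≡ 3 (mod 8)` is not a product of primes `≡ 1 (mod 8)`.
* §2 ★ `jacobiSym_eq_one_of_dvd_sq_sub_two_mul` — `p ≡ 7`, `ℓ ≡ 3 (mod 8)` primes, `ℓ ∣ x² − 2p` ⟹ `(ℓ/p) = +1`
  (`(2p/ℓ) = (x²/ℓ) = 1`, `(2/ℓ) = −1`, so `(p/ℓ) = −1`; reciprocity for `p ≡ ℓ ≡ 3 (mod 4)`).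
* §3 ★ `residuePin_of_shrinkingDisc` — `p ≡ 7 (mod 8)` prime, `a, b` odd, `x² = 2p + a² + 2b²` ⟹ a prime `ℓ ≡ 3 (mod 8)` with
  `(ℓ/p) = +1` and `ℓ ∣ a² + 2b²` (so `ℓ ≤ a² + 2b²`); `residuePin_of_shrinkingDisc_rpow` carries the card's bound
  `a² + 2b² ≤ p^{1−δ}` to `ℓ ≤ p^{1−δ}`; `residuePinA_of_dukeShrinkingDiscPin` is the card's implication
  `DukeShrinkingDiscPin η δ ⟹ ResiduePinA η δ` with the class-number side condition `h(−4p) ≥ p^{1/2−η}` carried as an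
  ARBITRARY predicate `C p` (it plays no role in the elementary step).

HONEST FRAMING: elementary number theory only; the SUPPLY `DukeShrinkingDiscPin` (Duke 1988 / Iwaniec 1987 equidistribution
of Heegner points of discriminant `−4p` with a shrinking target, Young 2017) is a print / XL fact NOT touched here; crux 21381
and BSD are NOT proved. No definition, no named fact, no `sorry`; axioms standard.
[cite: Cox2013, §1 (primes of the form x² + 2y²: (−2/ℓ) = 1 ⟺ ℓ ≡ 1, 3 (mod 8))]
-/

namespace Summit.BirchSwinnertonDyer.BirchSwinnertonDyer.Theorems.DukeBilinearCells

open Literature.NumberTheory.EllipticCurves.HeathBrown1994.Families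

/-! ## §1 `a² + 2b²` with `a, b` odd has a prime factor `≡ 3 (mod 8)` -/

/-- **Prime divisors of a primitive `a² + 2b²` are `≡ 1, 3 (mod 8)`**: if `ℓ` is an odd prime with `ℓ ∣ a² + 2b²` and
`ℓ ∤ b`, then `−2 ≡ (a/b)² (mod ℓ)` is a square, so `ℓ ≡ 1` or `3 (mod 8)`. [cite: Cox2013, §1 ((−2/ℓ) = 1 ⟺ ℓ ≡ 1, 3 (mod 8))] -/
theorem mod_eight_of_prime_dvd_sq_add_two_mul_sq {ℓ a b : ℕ} (hℓ : ℓ.Prime) (hℓ2 : ℓ ≠ 2)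
    (hdvd : ℓ ∣ a ^ 2 + 2 * b ^ 2) (hb : ¬ ℓ ∣ b) : ℓ % 8 = 1 ∨ ℓ % 8 = 3 := by
  haveI := Fact.mk hℓ
  rw [← ZMod.exists_sq_eq_neg_two_iff hℓ2]
  have h0 : ((a ^ 2 + 2 * b ^ 2 : ℕ) : ZMod ℓ) = 0 := (ZMod.natCast_eq_zero_iff _ _).mpr hdvd
  have hb0 : (b : ZMod ℓ) ≠ 0 := fun h => hb ((ZMod.natCast_eq_zero_iff _ _).mp h)
  push_cast at h0
  refine ⟨(a : ZMod ℓ) * (b : ZMod ℓ)⁻¹, ?_⟩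
  have hbinv : (b : ZMod ℓ) * (b : ZMod ℓ)⁻¹ = 1 := mul_inv_cancel₀ hb0
  have key : (a : ZMod ℓ) ^ 2 = -2 * (b : ZMod ℓ) ^ 2 := by linear_combination h0
  calc (-2 : ZMod ℓ) = -2 * ((b : ZMod ℓ) * (b : ZMod ℓ)⁻¹) ^ 2 := by rw [hbinv, one_pow, mul_one]
    _ = (a : ZMod ℓ) * (b : ZMod ℓ)⁻¹ * ((a : ZMod ℓ) * (b : ZMod ℓ)⁻¹) := by
      linear_combination (-((b : ZMod ℓ)⁻¹ ^ 2)) * key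

/-- **A primitive `a² + 2b² ≡ 3 (mod 8)` has a prime factor `≡ 3 (mod 8)`** — more precisely every divisor `m ≡ 3 (mod 8)`
of `a² + 2b²` (`a` odd, `gcd(a, b) = 1`) has such a prime factor: the least prime factor of `m` is `≡ 1` or `3 (mod 8)`, and
in the first case `m/ℓ ≡ 3 (mod 8)` is a smaller such divisor. [cite: Cox2013, §1 ((−2/ℓ) = 1 ⟺ ℓ ≡ 1, 3 (mod 8))] -/
theorem exists_prime_dvd_mod_eight_eq_three_of_coprime {a b : ℕ} (ha : Odd a) (hab : Nat.Coprime a b) :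
    ∀ m : ℕ, m ∣ a ^ 2 + 2 * b ^ 2 → m % 8 = 3 → ∃ ℓ : ℕ, ℓ.Prime ∧ ℓ ∣ m ∧ ℓ % 8 = 3 := by
  intro m
  induction m using Nat.strong_induction_on with
  | _ m ih =>
    intro hm h3
    have hm1 : m ≠ 1 := by omega
    set ℓ := m.minFac with hℓdef
    have hℓ : ℓ.Prime := Nat.minFac_prime hm1
    have hℓm : ℓ ∣ m := Nat.minFac_dvd m
    have hℓT : ℓ ∣ a ^ 2 + 2 * b ^ 2 := hℓm.trans hm
    -- `ℓ` is odd (it divides the odd number `a² + 2b²`) and does not divide `b`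
    have hTodd : (a ^ 2 + 2 * b ^ 2) % 2 = 1 := by
      obtain ⟨k, hk⟩ := ha
      have : a ^ 2 = 4 * (k * (k + 1)) + 1 := by rw [hk]; ring
      omega
    have hℓ2 : ℓ ≠ 2 := by
      rintro h2
      rw [h2] at hℓT
      omega
    have hℓb : ¬ ℓ ∣ b := by
      intro hb
      have h2b : ℓ ∣ 2 * b ^ 2 := Dvd.dvd.mul_left (dvd_pow hb two_ne_zero) 2
      have ha2 : ℓ ∣ a ^ 2 := (Nat.dvd_add_right h2b).mp (by simpa [add_comm] using hℓT)
      have hℓa : ℓ ∣ a := hℓ.dvd_of_dvd_pow ha2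
      exact hℓ.one_lt.ne' (Nat.eq_one_of_dvd_coprimes hab hℓa hb)
    rcases mod_eight_of_prime_dvd_sq_add_two_mul_sq hℓ hℓ2 hℓT hℓb with h1 | h3'
    · -- `ℓ ≡ 1 (mod 8)`: recurse on `m / ℓ`
      obtain ⟨m', hm'⟩ := hℓm
      have hm'3 : m' % 8 = 3 := by
        have : m % 8 = (ℓ % 8) * (m' % 8) % 8 := by rw [hm', Nat.mul_mod]
        rw [h1, one_mul, Nat.mod_mod] at this
        omega
      have hℓ9 : 2 ≤ ℓ := hℓ.two_le
      have hm'lt : m' < m := by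
        have hm'pos : 0 < m' := by
          rcases Nat.eq_zero_or_pos m' with h | h
          · rw [h, mul_zero] at hm'; omega
          · exact h
        nlinarith
      have hm'm : m' ∣ m := Dvd.intro_left ℓ hm'.symm
      obtain ⟨ℓ', hℓ', hℓ'm', h3⟩ := ih m' hm'lt (hm'm.trans hm) hm'3
      exact ⟨ℓ', hℓ', hℓ'm'.trans hm'm, h3⟩
    · exact ⟨ℓ, hℓ, Nat.minFac_dvd m, h3'⟩

/-- ★ **`a² + 2b²` with `a, b` odd has a prime factor `ℓ ≡ 3 (mod 8)`** (divide by `gcd(a,b)²` and apply the primitive case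
to `a′² + 2b′² ≡ 1 + 2 ≡ 3 (mod 8)`). [cite: Cox2013, §1 ((−2/ℓ) = 1 ⟺ ℓ ≡ 1, 3 (mod 8))] -/
theorem exists_prime_dvd_mod_eight_eq_three {a b : ℕ} (ha : Odd a) (hb : Odd b) :
    ∃ ℓ : ℕ, ℓ.Prime ∧ ℓ % 8 = 3 ∧ ℓ ∣ a ^ 2 + 2 * b ^ 2 := by
  obtain ⟨a', b', hcop, ha', hb'⟩ := Nat.exists_coprime a b
  set g := Nat.gcd a b with hgdef
  have ha'odd : Odd a' := by
    have h : Odd (a' * g) := by rw [← ha']; exact ha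
    exact (Nat.odd_mul.mp h).1
  have hb'odd : Odd b' := by
    have h : Odd (b' * g) := by rw [← hb']; exact hb
    exact (Nat.odd_mul.mp h).1
  have hT' : (a' ^ 2 + 2 * b' ^ 2) % 8 = 3 := by
    -- odd squares are `≡ 1 (mod 8)` (tree: `ModularForms.sq_mod_eight_of_odd`, inlined)
    obtain ⟨k, hk⟩ := ha'odd
    obtain ⟨i, hi⟩ := Nat.even_mul_succ_self k
    obtain ⟨k', hk'⟩ := hb'odd
    obtain ⟨i', hi'⟩ := Nat.even_mul_succ_self k'
    have h1 : a' ^ 2 = 4 * (k * (k + 1)) + 1 := by rw [hk]; ring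
    have h2 : b' ^ 2 = 4 * (k' * (k' + 1)) + 1 := by rw [hk']; ring
    rw [hi] at h1
    rw [hi'] at h2
    omega
  obtain ⟨ℓ, hℓ, hℓT', h3⟩ :=
    exists_prime_dvd_mod_eight_eq_three_of_coprime ha'odd hcop (a' ^ 2 + 2 * b' ^ 2) (dvd_refl _) hT'
  refine ⟨ℓ, hℓ, h3, hℓT'.trans ⟨g ^ 2, ?_⟩⟩
  rw [ha', hb']
  ring

/-! ## §2 `ℓ ∣ x² − 2p` makes `ℓ` a `(3,+)` prime -/

/-- ★ **`(ℓ/p) = +1` for a prime `ℓ ≡ 3 (mod 8)` dividing `x² − 2p`, `p ≡ 7 (mod 8)` prime**: `ℓ ∤ x` (else `ℓ ∣ 2p`), so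
`(2p/ℓ) = (x²/ℓ) = 1`; `(2/ℓ) = −1` gives `(p/ℓ) = −1`, and reciprocity for `p ≡ ℓ ≡ 3 (mod 4)` gives `(ℓ/p) = +1`.
[cite: Cox2013, §1 ((−2/ℓ) = 1 ⟺ ℓ ≡ 1, 3 (mod 8))] -/
theorem jacobiSym_eq_one_of_dvd_sq_sub_two_mul {p ℓ : ℕ} (hp : p.Prime) (hℓ : ℓ.Prime) (hp8 : p % 8 = 7)
    (hℓ8 : ℓ % 8 = 3) {x : ℤ} (hdvd : (ℓ : ℤ) ∣ x ^ 2 - 2 * p) : jacobiSym (ℓ : ℤ) p = 1 := by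
  -- `ℓ ∤ x`
  have hℓx : ¬ (ℓ : ℤ) ∣ x := by
    intro hx
    have h2p : (ℓ : ℤ) ∣ 2 * (p : ℤ) := by
      have := dvd_sub (dvd_pow hx two_ne_zero) hdvd
      rwa [sub_sub_cancel] at this
    have h2p' : ℓ ∣ 2 * p := by exact_mod_cast h2p
    rcases (Nat.Prime.dvd_mul hℓ).mp h2p' with h | h
    · have := Nat.le_of_dvd two_pos h
      omega
    · rw [(Nat.prime_dvd_prime_iff_eq hℓ hp).mp h] at hℓ8
      omega
  -- `(2p/ℓ) = (x²/ℓ) = 1`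
  have hmod : (2 * (p : ℤ)) % (ℓ : ℤ) = x ^ 2 % (ℓ : ℤ) := by
    have : 2 * (p : ℤ) ≡ x ^ 2 [ZMOD (ℓ : ℤ)] := Int.modEq_iff_dvd.mpr hdvd
    exact this
  have hgcd : x.gcd ℓ = 1 := by
    have hcop : Nat.Coprime ℓ x.natAbs :=
      (Nat.Prime.coprime_iff_not_dvd hℓ).mpr (fun h => hℓx (Int.natCast_dvd.mpr h))
    rw [Int.gcd, Int.natAbs_natCast]
    exact hcop.symm
  have h2p1 : jacobiSym (2 * (p : ℤ)) ℓ = 1 := by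
    rw [jacobiSym.mod_left' hmod]
    exact jacobiSym.sq_one' hgcd
  rw [jacobiSym.mul_left, jacobiSym_two_eq_neg_one (Or.inl hℓ8)] at h2p1
  -- `(p/ℓ) = −1`, reciprocity
  have hpℓ : jacobiSym (p : ℤ) ℓ = -1 := by linear_combination -h2p1
  rw [jacobiSym.quadratic_reciprocity_three_mod_four (by omega) (by omega), hpℓ, neg_neg]

/-! ## §3 The pin: `DukeShrinkingDiscPin ⟹ ResiduePinA` -/

/-- ★ **The `(3,+)` pin from the shrinking disc.** For a prime `p ≡ 7 (mod 8)` and odd `a, b` with `x² = 2p + a² + 2b²`: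
there is a prime `ℓ ≡ 3 (mod 8)` with `(ℓ/p) = +1` dividing `a² + 2b²` (hence `ℓ ≤ a² + 2b²`).
[cite: Cox2013, §1 ((−2/ℓ) = 1 ⟺ ℓ ≡ 1, 3 (mod 8))] -/
theorem residuePin_of_shrinkingDisc {p : ℕ} (hp : p.Prime) (hp8 : p % 8 = 7) {x a b : ℕ} (ha : Odd a) (hb : Odd b)
    (hx : x ^ 2 = 2 * p + a ^ 2 + 2 * b ^ 2) :
    ∃ ℓ : ℕ, ℓ.Prime ∧ ℓ % 8 = 3 ∧ jacobiSym (ℓ : ℤ) p = 1 ∧ ℓ ∣ a ^ 2 + 2 * b ^ 2 ∧ ℓ ≤ a ^ 2 + 2 * b ^ 2 := by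
  obtain ⟨ℓ, hℓ, h3, hℓT⟩ := exists_prime_dvd_mod_eight_eq_three ha hb
  have hT : ((a ^ 2 + 2 * b ^ 2 : ℕ) : ℤ) = (x : ℤ) ^ 2 - 2 * p := by
    have : ((x ^ 2 : ℕ) : ℤ) = ((2 * p + a ^ 2 + 2 * b ^ 2 : ℕ) : ℤ) := by rw [hx]
    push_cast at this ⊢
    linear_combination -this
  have hdvd : (ℓ : ℤ) ∣ (x : ℤ) ^ 2 - 2 * p := by
    rw [← hT]
    exact_mod_cast hℓT
  have hpos : 0 < a ^ 2 + 2 * b ^ 2 := lt_of_lt_of_le (pow_pos ha.pos 2) (Nat.le_add_right _ _)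
  exact ⟨ℓ, hℓ, h3, jacobiSym_eq_one_of_dvd_sq_sub_two_mul hp hℓ hp8 h3 hdvd, hℓT, Nat.le_of_dvd hpos hℓT⟩

/-- **With the card's size bound**: if moreover `a² + 2b² ≤ p^{1−δ}` (real exponent), the `(3,+)` prime satisfies
`ℓ ≤ p^{1−δ}`. [cite: Cox2013, §1 ((−2/ℓ) = 1 ⟺ ℓ ≡ 1, 3 (mod 8))] -/
theorem residuePin_of_shrinkingDisc_rpow {p : ℕ} (hp : p.Prime) (hp8 : p % 8 = 7) {x a b : ℕ} (ha : Odd a)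
    (hb : Odd b) (hx : x ^ 2 = 2 * p + a ^ 2 + 2 * b ^ 2) {δ : ℝ}
    (hsmall : ((a ^ 2 + 2 * b ^ 2 : ℕ) : ℝ) ≤ (p : ℝ) ^ (1 - δ)) :
    ∃ ℓ : ℕ, ℓ.Prime ∧ ℓ % 8 = 3 ∧ jacobiSym (ℓ : ℤ) p = 1 ∧ (ℓ : ℝ) ≤ (p : ℝ) ^ (1 - δ) := by
  obtain ⟨ℓ, hℓ, h3, hJ, -, hle⟩ := residuePin_of_shrinkingDisc hp hp8 ha hb hx
  exact ⟨ℓ, hℓ, h3, hJ, le_trans (by exact_mod_cast hle) hsmall⟩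

/-- ★ **The card's implication `DukeShrinkingDiscPin η δ ⟹ ResiduePinA η δ`**, with the class-number side condition
(`p^{1/2−η} ≤ h(−4p)` in the card) carried as an arbitrary predicate `C` on `p`: if beyond `p₀` every prime `p ≡ 7 (mod 8)`
with `C p` admits odd `a, b, x` with `x² = 2p + a² + 2b²`, `a² + 2b² ≤ p^{1−δ}`, then beyond `p₀` every such `p` admits a
`(3,+)` prime `ℓ ≡ 3 (mod 8)`, `(ℓ/p) = 1`, `ℓ ≤ p^{1−δ}`. [cite: Cox2013, §1 ((−2/ℓ) = 1 ⟺ ℓ ≡ 1, 3 (mod 8))] -/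
theorem residuePinA_of_dukeShrinkingDiscPin (C : ℕ → Prop) (δ : ℝ)
    (hDuke : ∃ p₀ : ℕ, ∀ p : ℕ, p.Prime → p₀ ≤ p → p % 8 = 7 → C p →
      ∃ x a b : ℕ, Odd a ∧ Odd b ∧ x ^ 2 = 2 * p + a ^ 2 + 2 * b ^ 2 ∧
        ((a ^ 2 + 2 * b ^ 2 : ℕ) : ℝ) ≤ (p : ℝ) ^ (1 - δ)) :
    ∃ p₀ : ℕ, ∀ p : ℕ, p.Prime → p₀ ≤ p → p % 8 = 7 → C p →
      ∃ ℓ : ℕ, ℓ.Prime ∧ ℓ % 8 = 3 ∧ jacobiSym (ℓ : ℤ) p = 1 ∧ (ℓ : ℝ) ≤ (p : ℝ) ^ (1 - δ) := by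
  obtain ⟨p₀, h⟩ := hDuke
  refine ⟨p₀, fun p hp hp₀ hp8 hC => ?_⟩
  obtain ⟨x, a, b, ha, hb, hx, hsmall⟩ := h p hp hp₀ hp8 hC
  exact residuePin_of_shrinkingDisc_rpow hp hp8 ha hb hx hsmall

end Summit.BirchSwinnertonDyer.BirchSwinnertonDyer.Theorems.DukeBilinearCells
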